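import Summits.BirchSwinnertonDyer.BirchSwinnertonDyer.Theorems.AdditiveBranchIMCGordTwoTwistedFieldTwoAuxKronecker
import Summits.BirchSwinnertonDyer.BirchSwinnertonDyer.Theorems.AdditiveBranchIMCGordTwoRankZeroOffCaseOneFieldSupplyR0Class
import Summits.BirchSwinnertonDyer.BirchSwinnertonDyer.Theorems.AdditiveBranchIMCGenusGrossZagierHeegnerOne
import HarnessLib

/-!
# KRONECKER VARIANT (LEAD g17, brick «λ₂-flip»): this file is `…TwistedFieldTwoClass.lean` (LEAD g15, p801124) VERBATIM with the hypothesis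
# `2 ∣ N_E → p ≡ ±1 (mod 8)` REMOVED — Stage 1 is now `exists_auxTwist_twisted_kronecker` (Kronecker root-number engine); nothing else changes.
-/

/-!
# FieldTwoTwisted, design D2, STAGE 2 (Class′): the `p`-ramified class WITH THE TWISTED WAN PRIME SPLIT, and its rank-zero partner `A`
# (crux 19357, line `three_field_road`, stub `stub_twistedWanChainR0`; LEAD g15, LeadReport23 §7–§9)

Theorems only. Inputs as `ThreeFieldRoadSupply.exists_ramifiedClass_partner` (Friedberg–Hoffstein Thm. B with prescribed splitting,
modularity), on the twisted Wan road: `(E, p)` on the (G-ord, `e = 2`) cell, `p ≥ 5`, `w(E) = +1`, `ρ̄_{E,p}` onto, odd additive primes of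
twist type, `E` not additive at `2`, `2 ∣ N_E → p ≡ ±1 (8)`, `K` a twisted road field at `q` (`TameRoadFieldTwisted`), `Wd` a globally
minimal model of `E^{(d_K)}`. With the auxiliary twist `X ≅ V^{(D′)}`, `D′ = d_K ℓ₀*`, `w(X) = −1` of Stage 1 (p800833), FH gives a
square-free `d < 0`, `d ≡ 1 (8)`, `(d/ℓ) = 1` at the odd primes of `2 p q ℓ₀ N_E N_{Wd} d_K` and of `N_X`, `L(X^{(d)}, 1) ≠ 0`; then
`A :=` a globally minimal model of `X^{(d)}`, `u := p* D′ d` (`A ≅ E^{(u)}`), `d'' := p* ℓ₀* d < 0` fundamental, `K'' := ℚ(√d'')`,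
`A ≅ Wd^{(d'')}` (`d_K d'' = u`). Every prime `ℓ ≠ p` of `N_E N_{Wd}` — the twisted Wan prime `q` INCLUDED — satisfies the Heegner
hypothesis in `K''` (`(d''/ℓ) = (p*/ℓ)(ℓ₀*/ℓ)(d/ℓ) = (p*/ℓ)² = 1`), the only common prime of `d''` and `N_E N_{Wd}` is `p`, `u` is a square
at every bad prime `∉ {p, q}` of `E`, and `A` has analytic rank `0`, is good ordinary at `p`, with `ρ̄_{A,p}` onto.

* `exists_splitClass_partner_twisted`.

BSD is proved for no curve. References: [FriedbergHoffstein1995] Thm. B; [JetchevSkinnerWan2017] §7.4.1; [SilvermanAEC2009] X.5 Cor. 5.4.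
-/

set_option linter.dupNamespace false
set_option autoImplicit false

noncomputable section

open scoped Classical

open WeierstrassCurve IsDedekindDomain IsDedekindDomain.HeightOneSpectrum NumberField Rat.HeightOneSpectrum
  Literature.NumberTheory.EllipticCurves Literature.NumberTheory.EllipticCurves.ModularForms
  Literature.NumberTheory.EllipticCurves.Rank1Residual Literature.NumberTheory.QuadraticFields
  Summit.BirchSwinnertonDyer.Rank1Residual Summit.BirchSwinnertonDyer.Rank1Residual.Additive
  Summit.BirchSwinnertonDyer.BirchSwinnertonDyer.Theorems

namespace Summit.BirchSwinnertonDyer.BirchSwinnertonDyer.Theorems.TwistedWanRoad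

open NumberTheorySymbols
open Summit.BirchSwinnertonDyer.BirchSwinnertonDyer.Theorems.AdditiveKoly.RamifiedHabitat (pStar_emod_four eq_of_prime_dvd_pStar)
open Summit.BirchSwinnertonDyer.BirchSwinnertonDyer.Theorems.ThreeFieldRoadSupply (discr_emod_eight_of_two_split jacobiSym_mul_self_eq_one
  natAbs_pStar squarefree_pStar not_dvd_of_jacobiSym_eq_one)

section Class

variable (W : WeierstrassCurve ℚ) [W.IsElliptic] [W.IsGloballyMinimal] (p : ℕ) [hp : Fact p.Prime]
  {q : ℕ} [hq : Fact q.Prime] (K : Type) [Field K] [NumberField K]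
  {Wd : WeierstrassCurve ℚ} [Wd.IsElliptic] [Wd.IsGloballyMinimal]

omit [Wd.IsGloballyMinimal] in
/-- **FieldTwoTwisted (design D2), Stage 2 — the `p`-ramified class with `q` split and its rank-zero good-ordinary partner**
(see the module docstring for the construction and the list of conclusions).
[cite: FriedbergHoffstein1995, Thm. B (1), as applied in JetchevSkinnerWan2017 §7.4.1] [cite: SilvermanAEC2009, X.5 Cor. 5.4 and App. C §16] -/
theorem exists_splitClass_partner_twisted_kronecker
    (hFH : friedbergHoffstein_exists_heegnerField_splitDivisors_twist_ne_zero)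
    (hmod : exists_isNewformOf) (hL : hasEntireLFunction_rat)
    (hp5 : 5 ≤ p) (hw : W.rootNumber = 1) (hcell : N10.CellGordTwo W p) (hsurj : Surj W p)
    (htt : ∀ r : Nat.Primes, (r : ℕ) ≠ 2 → W.HasAdditiveReductionAt ((primesEquiv (R := ℤ)).symm r) →
      ¬ (W.quadraticTwist (((-1 : ℤ) ^ ((r : ℕ) / 2) * r : ℤ) : ℚ)).HasAdditiveReductionAt ((primesEquiv (R := ℤ)).symm r))
    (h2 : ¬ W.HasAdditiveReductionAt ((primesEquiv (R := ℤ)).symm ⟨2, Nat.prime_two⟩))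
    (hK : TameRoadFieldTwisted W p q K)
    (Cd : VariableChange ℚ) (hWd : Cd • W.quadraticTwist (NumberField.discr K : ℚ) = Wd) :
    ∃ (ℓ₀ : ℕ) (D' d : ℤ) (K'' : Type) (_ : Field K'') (_ : NumberField K'')
      (A : WeierstrassCurve ℚ) (_ : A.IsElliptic) (_ : A.IsGloballyMinimal),
      ℓ₀.Prime ∧ ℓ₀ ≠ p ∧ ℓ₀ ≠ q ∧ ℓ₀ ≠ 2 ∧ ¬ ℓ₀ ∣ Wd.conductorNorm ℤ ∧ ¬ ℓ₀ ∣ W.conductorNorm ℤ ∧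
      NumberField.discr K'' = ((-1 : ℤ) ^ (p / 2) * p) * ((-1 : ℤ) ^ (ℓ₀ / 2) * ℓ₀) * d ∧
      IsImaginaryQuadratic K'' ∧
      (∀ ℓ : ℕ, ℓ.Prime → ℓ ∣ W.conductorNorm ℤ * Wd.conductorNorm ℤ → ℓ ≠ p → SatisfiesHeegnerHypothesis ℓ K'') ∧
      (∀ ℓ : ℕ, ℓ.Prime → (ℓ : ℤ) ∣ NumberField.discr K'' → ℓ ∣ W.conductorNorm ℤ * Wd.conductorNorm ℤ → ℓ = p) ∧
      jacobiSym (NumberField.discr K'') q = 1 ∧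
      (∃ C : VariableChange ℚ, C • Wd.quadraticTwist (NumberField.discr K'' : ℚ) = A) ∧
      D' = NumberField.discr K * ((-1 : ℤ) ^ (ℓ₀ / 2) * ℓ₀) ∧
      (∃ C : VariableChange ℚ, C • W.quadraticTwist ((((-1 : ℤ) ^ (p / 2) * p) * D' * d : ℤ) : ℚ) = A) ∧
      (((-1 : ℤ) ^ (p / 2) * p) * D' * d) % 4 = 1 ∧ Squarefree (((-1 : ℤ) ^ (p / 2) * p) * D' * d) ∧
      (∀ ℓ : ℕ, ℓ.Prime → ℓ ∣ W.conductorNorm ℤ → ℓ ≠ p → ℓ ≠ q →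
        (ℓ = 2 → (((-1 : ℤ) ^ (p / 2) * p) * D' * d) % 8 = 1) ∧
        (ℓ ≠ 2 → J(((-1 : ℤ) ^ (p / 2) * p) * D' * d | ℓ) = 1)) ∧
      A.analyticRank = 0 ∧ GoodOrd A p ∧ Surj A p := by
  have hK' := hK
  obtain ⟨hKiq, -, htw, -, hsplit, h2split, -⟩ := hK'
  obtain ⟨hqp, hq2, -, -, -⟩ := htw
  have hpq : p ≠ q := fun h ↦ hqp h.symm
  have hp2 : p ≠ 2 := by omega
  have hNW0 : W.conductorNorm ℤ ≠ 0 := (W.conductorNorm_pos_holds).ne'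
  have hNWd0 : Wd.conductorNorm ℤ ≠ 0 := (Wd.conductorNorm_pos_holds).ne'
  obtain ⟨V, iV, iVm, C', δ, ℓ₀, X, iX, iXm, CX, hC', hordV, hNWV, hfac, hδsq, hpδ, hqδ, hδ0, hℓ₀, hℓ₀p, hℓ₀q, hℓ₀2,
      hℓ₀M, hℓ₀δ, hpos, h8ls, h8out, hJls, -, hJdKp, hCX, hXroot⟩ :=
    exists_auxTwist_twisted_kronecker W p K hmod hp5 hw hcell htt h2 hK (Wd.conductorNorm ℤ) hNWd0
  -- notation (plain `obtain`s; see Stage 1)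
  obtain ⟨ps, hps⟩ : ∃ ps : ℤ, ps = (-1 : ℤ) ^ (p / 2) * p := ⟨_, rfl⟩
  obtain ⟨ls, hls⟩ : ∃ ls : ℤ, ls = (-1 : ℤ) ^ (ℓ₀ / 2) * ℓ₀ := ⟨_, rfl⟩
  set dK : ℤ := NumberField.discr K with hdK
  have h2K : ((Ideal.span {(2 : ℤ)}).primesOver (𝓞 K)).ncard = 2 := by
    by_cases h2N : 2 ∣ W.conductorNorm ℤ
    · exact hsplit 2 Nat.prime_two h2N (Ne.symm hq2)
    · exact h2split h2N
  obtain ⟨hdK8, hdK4, -, hdKsq⟩ := discr_emod_eight_of_two_split K hKiq h2K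
  rw [← hdK] at hdK8 hdK4 hdKsq
  clear_value dK
  have hdK0 : dK ≠ 0 := by rw [hdK]; exact NumberField.discr_ne_zero K
  have hdKneg : dK < 0 := by rw [hdK]; exact hKiq.discr_neg
  have hpN : p ∣ W.conductorNorm ℤ := (W.dvd_conductorNorm_iff_not_hasGoodReductionAtPrime p).mpr hcell.2.1.1
  have hps0 : ps ≠ 0 := by rw [hps]; exact mul_ne_zero (pow_ne_zero _ (by norm_num)) (by exact_mod_cast hp.out.ne_zero)
  have hls0 : ls ≠ 0 := by rw [hls]; exact mul_ne_zero (pow_ne_zero _ (by norm_num)) (by exact_mod_cast hℓ₀.ne_zero)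
  have hps4 : ps % 4 = 1 := by rw [hps]; exact pStar_emod_four (p := p) hp2
  have hls4 : ls % 4 = 1 := by rw [hls]; exact (haveI := Fact.mk hℓ₀; pStar_emod_four (p := ℓ₀) hℓ₀2)
  have hpos' : 0 < ps * ls := by rw [hps, hls]; exact hpos
  obtain ⟨M, hM⟩ : ∃ M : ℕ, M = W.conductorNorm ℤ * Wd.conductorNorm ℤ := ⟨_, rfl⟩
  have hM0 : M ≠ 0 := by rw [hM]; exact mul_ne_zero hNW0 hNWd0
  have hℓ₀M' : ¬ ℓ₀ ∣ M := by rw [hM]; exact hℓ₀M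
  have hℓ₀NW : ¬ ℓ₀ ∣ W.conductorNorm ℤ := fun h ↦ hℓ₀M (h.mul_right _)
  have hℓ₀NWd : ¬ ℓ₀ ∣ Wd.conductorNorm ℤ := fun h ↦ hℓ₀M (h.mul_left _)
  have hℓ₀dK : ¬ (ℓ₀ : ℤ) ∣ dK := by
    rw [hfac]; intro h
    rcases Int.Prime.dvd_mul' hℓ₀ h with h | h
    · exact hℓ₀q (eq_of_prime_dvd_pStar (p := q) hℓ₀ h)
    · exact hℓ₀δ h
  have hpdK : ¬ (p : ℤ) ∣ dK := not_dvd_of_jacobiSym_eq_one hp.out hJdKp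
  have hJls' : ∀ r : ℕ, r.Prime → r ∣ M → r ≠ 2 → r ≠ p → J(ls | r) = J(ps | r) := by
    intro r hr hrM hr2 hrp; rw [hls, hps]; exact hJls r hr (hM ▸ hrM) hr2 hrp
  -- the twist parameter `D' = d_K ℓ₀*` of Stage 1
  obtain ⟨D', hD'⟩ : ∃ D' : ℤ, D' = dK * ls := ⟨_, rfl⟩
  have hD'0 : D' ≠ 0 := by rw [hD']; exact mul_ne_zero hdK0 hls0
  have hD'4 : D' % 4 = 1 := by rw [hD', Int.mul_emod, hdK4, hls4]; decide
  have hD'Q : (D' : ℚ) ≠ 0 := by exact_mod_cast hD'0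
  have hCX' : CX • X = V.quadraticTwist ((D' : ℤ) : ℚ) := by rw [hD', hls]; exact hCX
  haveI := V.isElliptic_quadraticTwist hD'Q
  -- §e Friedberg–Hoffstein on `X`
  obtain ⟨SFH, hSFH⟩ : ∃ S : Finset ℕ, S = (2 * p * q * ℓ₀ * M * dK.natAbs).primeFactors := ⟨_, rfl⟩
  have hSFH0 : 2 * p * q * ℓ₀ * M * dK.natAbs ≠ 0 := by
    refine mul_ne_zero (mul_ne_zero (mul_ne_zero (mul_ne_zero (mul_ne_zero two_ne_zero
      hp.out.ne_zero) hq.out.ne_zero) hℓ₀.ne_zero) hM0) (Int.natAbs_ne_zero.mpr hdK0)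
  have hSFH_mem : ∀ ℓ : ℕ, ℓ.Prime → ℓ ∣ 2 * p * q * ℓ₀ * M * dK.natAbs → ℓ ∈ SFH := fun ℓ hℓ hd ↦ by
    rw [hSFH]; exact Nat.mem_primeFactors.mpr ⟨hℓ, hd, hSFH0⟩
  obtain ⟨d, hdneg, hdsq, hd8, -, hdS, -, hLd⟩ :=
    exists_neg_fundamental_twist_ne_zero_of_friedbergHoffstein hFH X hXroot SFH 0
  have hd0 : d ≠ 0 := hdneg.ne
  have hdq0 : (d : ℚ) ≠ 0 := by exact_mod_cast hd0
  have hd4 : d % 4 = 1 := by omega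
  have hdJ : ∀ ℓ : ℕ, ℓ.Prime → ℓ ∣ 2 * p * q * ℓ₀ * M * dK.natAbs → ℓ ≠ 2 → J(d | ℓ) = 1 :=
    fun ℓ hℓ hd h2 ↦ hdS ℓ (hSFH_mem ℓ hℓ hd) hℓ h2
  have hd_ndvd : ∀ ℓ : ℕ, ℓ.Prime → ℓ ∣ 2 * p * q * ℓ₀ * M * dK.natAbs → ¬ (ℓ : ℤ) ∣ d := by
    intro ℓ hℓ hd
    by_cases h2 : ℓ = 2
    · subst h2; intro h; omega
    · exact not_dvd_of_jacobiSym_eq_one hℓ (hdJ ℓ hℓ hd h2)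
  have hpd : ¬ (p : ℤ) ∣ d := hd_ndvd p hp.out ⟨2 * q * ℓ₀ * M * dK.natAbs, by ring⟩
  have hℓ₀d : ¬ (ℓ₀ : ℤ) ∣ d := hd_ndvd ℓ₀ hℓ₀ ⟨2 * p * q * M * dK.natAbs, by ring⟩
  have hdKd : ∀ ℓ : ℕ, ℓ.Prime → (ℓ : ℤ) ∣ dK → ¬ (ℓ : ℤ) ∣ d := fun ℓ hℓ hℓdK ↦
    hd_ndvd ℓ hℓ ((by simpa using Int.natAbs_dvd_natAbs.mpr hℓdK : ℓ ∣ dK.natAbs).mul_left _)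
  -- §f the partner `A`, a globally minimal model of `X^{(d)}`
  haveI := X.isElliptic_quadraticTwist hdq0
  obtain ⟨A, iA, iAm, CA, hCA⟩ := exists_isGloballyMinimal_smul_eq_quadraticTwist X hdq0
  have hrA : A.analyticRank = 0 := by
    rw [← analyticRank_smul A CA, hCA]
    exact ((X.quadraticTwist (d : ℚ)).analyticRank_eq_zero_iff_holds (hL _)).2 hLd
  -- §g the twist relations: `A ≅ V^{(D' d)} ≅ E^{(u)}`, `u = p* D' d`
  obtain ⟨u, hu⟩ : ∃ u : ℤ, u = ps * D' * d := ⟨_, rfl⟩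
  have hAV : ∃ C : VariableChange ℚ, C • A = V.quadraticTwist ((D' * d : ℤ) : ℚ) := by
    obtain ⟨C₃, hC₃⟩ : ∃ C₃ : VariableChange ℚ, C₃ = ⟨CX⁻¹.u, (d : ℚ) * CX⁻¹.r, 0, 0⟩ := ⟨_, rfl⟩
    have hX : X = CX⁻¹ • V.quadraticTwist (D' : ℚ) := by rw [← hCX', inv_smul_smul]
    have hparam : ((D' : ℚ)) * (d : ℚ) = ((D' * d : ℤ) : ℚ) := by push_cast; ring
    have e1 : X.quadraticTwist (d : ℚ) = C₃ • V.quadraticTwist ((D' * d : ℤ) : ℚ) := by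
      rw [hX, WeierstrassCurve.quadraticTwist_smul, quadraticTwist_quadraticTwist, ← hC₃, hparam]
    refine ⟨C₃⁻¹ * CA, ?_⟩
    rw [mul_smul, hCA, e1, inv_smul_smul]
  have hAW : ∃ C : VariableChange ℚ, C • W.quadraticTwist ((u : ℤ) : ℚ) = A := by
    obtain ⟨C₁, hC₁⟩ := hAV
    obtain ⟨C'', hC''⟩ : ∃ C'' : VariableChange ℚ, C'' = ⟨C'.u, ((u : ℤ) : ℚ) * C'.r, 0, 0⟩ := ⟨_, rfl⟩
    have hparam : ((-1 : ℚ) ^ (p / 2) * (p : ℚ)) * ((u : ℤ) : ℚ) =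
        ((D' * d : ℤ) : ℚ) * ((ps : ℤ) : ℚ) ^ 2 := by
      rw [hu, hps]; push_cast; ring
    have e1 : W.quadraticTwist ((u : ℤ) : ℚ) =
        C'' • V.quadraticTwist (((D' * d : ℤ) : ℚ) * ((ps : ℤ) : ℚ) ^ 2) := by
      rw [← hC', WeierstrassCurve.quadraticTwist_smul, quadraticTwist_quadraticTwist, ← hC'', hparam]
    have hpsQ0 : ((ps : ℤ) : ℚ) ≠ 0 := by exact_mod_cast hps0
    obtain ⟨C₂, hC₂⟩ := V.exists_variableChange_quadraticTwist_mul_sq (((D' * d : ℤ) : ℚ)) _ hpsQ0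
    have e2 : W.quadraticTwist ((u : ℤ) : ℚ) = (C'' * C₂ * C₁) • A := by
      rw [e1, ← hC₂, ← hC₁, mul_smul, mul_smul]
    exact ⟨(C'' * C₂ * C₁)⁻¹, by rw [e2, inv_smul_smul]⟩
  -- §h the discriminant `d'' = p* ℓ₀* d` and the field `K''`
  obtain ⟨D, hD⟩ : ∃ D : ℤ, D = ps * ls * d := ⟨_, rfl⟩
  have hDneg : D < 0 := by rw [hD]; exact mul_neg_of_pos_of_neg hpos' hdneg
  have hD4 : D % 4 = 1 := by
    rw [hD, Int.mul_emod, show (ps * ls) % 4 = 1 by rw [Int.mul_emod, hps4, hls4]; decide, hd4]; decide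
  have hD8 : 2 ∣ W.conductorNorm ℤ → D % 8 = 1 := fun h2N ↦ by
    rw [hD, Int.mul_emod, show (ps * ls) % 8 = 1 by rw [hps, hls]; exact h8out h2N, hd8]; decide
  have hDsq : Squarefree D := by
    rw [← Int.squarefree_natAbs]
    have hDabs : D.natAbs = p * ℓ₀ * d.natAbs := by
      rw [hD, Int.natAbs_mul, Int.natAbs_mul, hps, hls, natAbs_pStar, natAbs_pStar (p := ℓ₀)]
    rw [hDabs]
    have hcop1 : Nat.Coprime (p * ℓ₀) d.natAbs := by
      refine Nat.Coprime.mul_left ?_ ?_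
      · exact (Nat.Prime.coprime_iff_not_dvd hp.out).mpr fun h ↦ hpd (Int.natAbs_dvd_natAbs.mp (by simpa using h))
      · exact (Nat.Prime.coprime_iff_not_dvd hℓ₀).mpr fun h ↦ hℓ₀d (Int.natAbs_dvd_natAbs.mp (by simpa using h))
    rw [Nat.squarefree_mul hcop1]
    refine ⟨?_, Int.squarefree_natAbs.mpr hdsq⟩
    rw [Nat.squarefree_mul ((Nat.coprime_primes hp.out hℓ₀).mpr (Ne.symm hℓ₀p))]
    exact ⟨hp.out.prime.squarefree, hℓ₀.prime.squarefree⟩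
  obtain ⟨K'', iF'', iN'', h2'', hdisc''⟩ :=
    Quadratic.exists_numberField_discr_eq (D := D) (Or.inl ⟨hD4, hDsq, by omega⟩)
  have hK'' : IsImaginaryQuadratic K'' := isImaginaryQuadratic_of_discr_eq_of_neg h2'' hdisc'' hDneg
  -- §i `A ≅ Wd^{(d'')}`: `d_K · d'' = u`
  have hAWd : ∃ C : VariableChange ℚ, C • Wd.quadraticTwist (NumberField.discr K'' : ℚ) = A := by
    obtain ⟨C₁, hC₁⟩ := hAW
    obtain ⟨C₄, hC₄⟩ : ∃ C₄ : VariableChange ℚ, C₄ = ⟨Cd.u, ((D : ℤ) : ℚ) * Cd.r, 0, 0⟩ := ⟨_, rfl⟩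
    have hparam : ((dK : ℤ) : ℚ) * ((D : ℤ) : ℚ) = ((u : ℤ) : ℚ) := by
      rw [hD, hu, hD']; push_cast; ring
    have e1 : Wd.quadraticTwist ((D : ℤ) : ℚ) = C₄ • W.quadraticTwist ((u : ℤ) : ℚ) := by
      rw [← hWd, WeierstrassCurve.quadraticTwist_smul, quadraticTwist_quadraticTwist, ← hC₄, hparam]
    have hWu : W.quadraticTwist ((u : ℤ) : ℚ) = C₁⁻¹ • A := by rw [← hC₁, inv_smul_smul]
    have e2 : Wd.quadraticTwist ((D : ℤ) : ℚ) = (C₄ * C₁⁻¹) • A := by rw [e1, hWu, smul_smul]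
    refine ⟨(C₄ * C₁⁻¹)⁻¹, ?_⟩
    rw [hdisc'', e2, inv_smul_smul]
  -- §j good ordinary at `p`, surjective at `p`
  have hD'd_sq : Squarefree (D' * d) := by
    rw [squarefree_mul_iff]
    refine ⟨?_, ?_, hdsq⟩
    · refine (Int.isCoprime_iff_gcd_eq_one.mpr ?_).isRelPrime
      rw [Int.gcd_eq_natAbs]
      refine Nat.coprime_of_dvd fun ℓ hℓ hℓD hℓd ↦ hd_ndvd ℓ hℓ ?_ (Int.natAbs_dvd_natAbs.mp (by simpa using hℓd))
      have hℓD' : (ℓ : ℤ) ∣ D' := Int.natAbs_dvd_natAbs.mp (by simpa using hℓD)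
      rw [hD'] at hℓD'
      rcases Int.Prime.dvd_mul' hℓ hℓD' with h | h
      · have hℓdK : ℓ ∣ dK.natAbs := by simpa using Int.natAbs_dvd_natAbs.mpr h
        exact hℓdK.mul_left _
      · rw [hls] at h
        rw [(haveI := Fact.mk hℓ₀; eq_of_prime_dvd_pStar (p := ℓ₀) hℓ h)]
        exact ⟨2 * p * q * M * dK.natAbs, by ring⟩
    · rw [hD', squarefree_mul_iff]
      refine ⟨?_, hdKsq, ?_⟩
      · refine (Int.isCoprime_iff_gcd_eq_one.mpr ?_).isRelPrime
        rw [Int.gcd_comm, Int.gcd_eq_natAbs, hls, natAbs_pStar]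
        exact (Nat.Prime.coprime_iff_not_dvd hℓ₀).mpr fun h ↦ hℓ₀dK (Int.natAbs_dvd_natAbs.mp (by simpa using h))
      · rw [hls]; exact (haveI := Fact.mk hℓ₀; squarefree_pStar (p := ℓ₀))
  have hpD'd : ¬ (p : ℤ) ∣ D' * d := by
    intro h
    rcases Int.Prime.dvd_mul' hp.out h with h | h
    · rw [hD'] at h
      rcases Int.Prime.dvd_mul' hp.out h with h | h
      · exact hpdK h
      · rw [hls] at h
        exact hℓ₀p ((haveI := Fact.mk hℓ₀; eq_of_prime_dvd_pStar (p := ℓ₀) hp.out h)).symm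
    · exact hpd h
  have hgoA : GoodOrd A p := by
    obtain ⟨C₁, hC₁⟩ := hAV
    have hord : IsOrdinaryAt A p :=
      isOrdinaryAt_of_smul_eq_quadraticTwist V A hD'd_sq hC₁ p hp2 hpD'd ⟨hordV.1, hordV.2⟩
    exact ⟨hord.1, hord.2⟩
  have hu0 : u ≠ 0 := by rw [hu]; exact mul_ne_zero (mul_ne_zero hps0 hD'0) hd0
  have huq : ((u : ℤ) : ℚ) ≠ 0 := by exact_mod_cast hu0
  have hsurjA : Surj A p := (Additive.surj_iff_of_model_twist W p huq hAW).mpr hsurj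
  -- §k arithmetic of `u = p* D' d`
  have hu4 : u % 4 = 1 := by
    rw [hu, Int.mul_emod, show (ps * D') % 4 = 1 by rw [Int.mul_emod, hps4, hD'4]; decide, hd4]; decide
  have husq : Squarefree u := by
    rw [hu, mul_assoc, squarefree_mul_iff]
    refine ⟨?_, by rw [hps]; exact squarefree_pStar, hD'd_sq⟩
    refine (Int.isCoprime_iff_gcd_eq_one.mpr ?_).isRelPrime
    rw [Int.gcd_eq_natAbs, hps, natAbs_pStar]
    exact (Nat.Prime.coprime_iff_not_dvd hp.out).mpr fun h ↦ hpD'd (Int.natAbs_dvd_natAbs.mp (by simpa using h))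
  have hJu : ∀ ℓ : ℕ, ℓ.Prime → ℓ ∣ W.conductorNorm ℤ → ℓ ≠ p → ℓ ≠ q →
      (ℓ = 2 → u % 8 = 1) ∧ (ℓ ≠ 2 → J(u | ℓ) = 1) := by
    intro ℓ hℓ hℓW hℓp hℓq
    have hℓM : ℓ ∣ M := by rw [hM]; exact hℓW.mul_right _
    refine ⟨fun h2 ↦ ?_, fun h2 ↦ ?_⟩
    · subst h2
      rw [hu, hD', show ps * (dK * ls) * d = (ps * ls) * dK * d by ring, Int.mul_emod,
        show (ps * ls * dK) % 8 = 1 by rw [Int.mul_emod, show (ps * ls) % 8 = 1 by rw [hps, hls]; exact h8out hℓW, hdK8]; decide,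
        hd8]; decide
    · have hdKℓ : J(dK | ℓ) = 1 := by
        rw [hdK]; exact (Quadratic.ncard_primesOver_eq_two_iff_jacobiSym hKiq.1 hℓ h2).mp (hsplit ℓ hℓ hℓW hℓq)
      have hJd : J(d | ℓ) = 1 := hdJ ℓ hℓ (hℓM.trans ⟨2 * p * q * ℓ₀ * dK.natAbs, by ring⟩) h2
      have hpsℓ : ¬ (ℓ : ℤ) ∣ ps := by rw [hps]; exact fun hd ↦ hℓp (eq_of_prime_dvd_pStar (p := p) hℓ hd)
      rw [hu, hD', show ps * (dK * ls) * d = (ps * ls) * (dK * d) by ring, jacobiSym.mul_left, jacobiSym.mul_left,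
        jacobiSym.mul_left, hJls' ℓ hℓ hℓM h2 hℓp, hdKℓ, hJd, mul_one, mul_one]
      exact jacobiSym_mul_self_eq_one hℓ hpsℓ
  -- §l splitting and ramification in `K''`
  have hJD : ∀ r : ℕ, r.Prime → r ∣ M → r ≠ 2 → r ≠ p → J(D | r) = 1 := by
    intro r hr hrM hr2 hrp
    have hJd : J(d | r) = 1 := hdJ r hr (hrM.trans ⟨2 * p * q * ℓ₀ * dK.natAbs, by ring⟩) hr2
    have hpsr : ¬ (r : ℤ) ∣ ps := by rw [hps]; exact fun hd ↦ hrp (eq_of_prime_dvd_pStar (p := p) hr hd)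
    rw [hD, jacobiSym.mul_left, jacobiSym.mul_left, hJls' r hr hrM hr2 hrp, hJd, mul_one]
    exact jacobiSym_mul_self_eq_one hr hpsr
  have h2M : 2 ∣ M → 2 ∣ W.conductorNorm ℤ := by
    intro h2M
    rw [hM] at h2M
    rcases (Nat.Prime.dvd_mul Nat.prime_two).mp h2M with h | h
    · exact h
    · -- `f₂(Wd) = f₂(E)`: `Wd ≅ E^{(d_K)}`, `d_K ≡ 1 (mod 4)` a unit at `2`
      have h2dK : ¬ ((2 : ℕ) : ℤ) ∣ dK := by omega
      haveI := Fact.mk Nat.prime_two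
      have hf := GenusGrossZagier.factorization_conductorNorm_quadraticTwist_of_one_mod_four W (ℓ := 2) hdK4 h2dK
      have hdKQ : (dK : ℚ) ≠ 0 := by exact_mod_cast hdK0
      haveI := W.isElliptic_quadraticTwist hdKQ
      have hNWd : Wd.conductorNorm ℤ = (W.quadraticTwist (dK : ℚ)).conductorNorm ℤ := by
        rw [← hWd, conductorNorm_smul_rat]
      have h1 : 1 ≤ (Wd.conductorNorm ℤ).factorization 2 :=
        (Nat.Prime.dvd_iff_one_le_factorization Nat.prime_two hNWd0).mp h
      rw [hNWd, hf] at h1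
      exact (Nat.Prime.dvd_iff_one_le_factorization Nat.prime_two hNW0).mpr h1
  have hsplit'' : ∀ ℓ : ℕ, ℓ.Prime → ℓ ∣ M → ℓ ≠ p → SatisfiesHeegnerHypothesis ℓ K'' := by
    intro ℓ hℓ hℓM hℓp
    refine (satisfiesHeegnerHypothesis_iff_kronecker ℓ K'' h2'').mpr fun r hr hrℓ ↦ ?_
    obtain rfl : r = ℓ := (Nat.prime_dvd_prime_iff_eq hr hℓ).mp hrℓ
    rw [hdisc'']
    exact ⟨fun h2 ↦ hD8 (h2M (h2 ▸ hℓM)), fun h2 ↦ hJD r hr hℓM h2 hℓp⟩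
  have hram'' : ∀ ℓ : ℕ, ℓ.Prime → (ℓ : ℤ) ∣ NumberField.discr K'' → ℓ ∣ M → ℓ = p := by
    intro ℓ hℓ hℓD hℓM
    rw [hdisc'', hD] at hℓD
    rcases Int.Prime.dvd_mul' hℓ hℓD with h | h
    · rcases Int.Prime.dvd_mul' hℓ h with h | h
      · rw [hps] at h; exact eq_of_prime_dvd_pStar (p := p) hℓ h
      · rw [hls] at h
        exact (hℓ₀M' ((haveI := Fact.mk hℓ₀; eq_of_prime_dvd_pStar (p := ℓ₀) hℓ h) ▸ hℓM)).elim
    · exact (hd_ndvd ℓ hℓ (hℓM.trans ⟨2 * p * q * ℓ₀ * dK.natAbs, by ring⟩) h).elim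
  have hqM : q ∣ M := by
    rw [hM]
    refine Dvd.dvd.mul_right ?_ _
    obtain ⟨-, -, htw', -, -, -, -⟩ := hK
    obtain ⟨-, -, haddq, -, -⟩ := htw'
    by_contra hqN
    have hg := ((W.hasGoodReductionAtPrime_iff_hasGoodReductionAt_holds) ⟨q, hq.out⟩).mp
      (by by_contra hng; exact hqN ((W.dvd_conductorNorm_iff_not_hasGoodReductionAtPrime q).mpr hng))
    exact haddq.not_hasGoodReductionAt hg
  have hJDq : jacobiSym (NumberField.discr K'') q = 1 := by rw [hdisc'']; exact hJD q hq.out hqM hq2 hqp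
  -- outputs
  subst hps hls
  refine ⟨ℓ₀, D', d, K'', iF'', iN'', A, iA, iAm, hℓ₀, hℓ₀p, hℓ₀q, hℓ₀2, hℓ₀NWd, hℓ₀NW, ?_, hK'',
    fun ℓ hℓ hℓM hℓp ↦ hsplit'' ℓ hℓ (hM ▸ hℓM) hℓp, fun ℓ hℓ hℓD hℓM ↦ hram'' ℓ hℓ hℓD (hM ▸ hℓM), hJDq,
    hAWd, hD', ?_, ?_, ?_, ?_, hrA, hgoA, hsurjA⟩
  · rw [hdisc'', hD]
  · rw [← hu]; exact hAW
  · rw [← hu]; exact hu4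
  · rw [← hu]; exact husq
  · rw [← hu]; exact hJu

end Class

end Summit.BirchSwinnertonDyer.BirchSwinnertonDyer.Theorems.TwistedWanRoad

end
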